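import Literature.MathematicalPhysics.QuantumLattice.DysonExpansion
import Literature.MathematicalPhysics.QuantumLattice.FermionQuasiFree
import Mathlib.MeasureTheory.Integral.DominatedConvergence
import HarnessLib

/-!
# Dyson coefficients as ordered (simplex) integrals; the perturbation series of the Hubbard
two-point function in `U` with free time-ordered expectations as coefficients

Topic `MathematicalPhysics/QuantumLattice`; continuation of `DysonExpansion.lean` (the Dyson
terms `E_k`, `Matrix.hasSum_dyson_trace_gibbsWeight_mul`: `Tr(e^{-β(H₀+gV)} O) = Σ_k g^k Tr(E_k(1) O)`)
in the programme under the tree's fact `bgm_two_point_limit` (`HubbardFermiLiquid.lean`).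
Benfatto–Giuliani–Mastropietro (Ann. Henri Poincaré 7 (2006) 809, §2.1, pp. 5–6 of the held
arXiv text) start from "the usual formal power series in `U` for the partition function and for
the Schwinger functions of model (1.1)", rewritten as Grassmann integrals ((2.6), (2.8)); this
file makes that power series explicit at the operator level, where it converges for every `U` in
finite volume:

* §1 `orderedIntegral k F t = ∫₀ᵗ du_{k-1} ∫₀^{u_{k-1}} ⋯ ∫₀^{u₁} du₀ F(u)` — the iterated integral over
  the ordered simplex (Bratteli–Robinson I, Thm. 3.1.33), its continuity in parameters
  (`continuous_orderedIntegral`, via `intervalIntegral.continuous_parametric_primitive_of_continuous`)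
  and commutation with continuous linear maps (`ContinuousLinearMap.orderedIntegral_comp_comm`).
* §2 **`dysonTerm_eq_orderedIntegral`**: `E_k(t) = ∫_{0≤u₀≤⋯≤u_{k-1}≤t} (∏_i e^{u_iA} B e^{-u_iA}) e^{tA} du`
  (ordered product), hence `Tr(E_k(1) O)` as an ordered integral; **`trace_dysonIntegrand_gibbs`**:
  for `A = -βH₀`, `B = -βV`, `V = Σ_r v_r W_r`, the integrand is
  `(-β)^k Σ_{f:[k]→R} (∏_i v_{f(i)}) Tr(e^{-βH₀} O ∏_i e^{s_iH₀} W_{f(i)} e^{-s_iH₀})`, `s_i = -βu_i`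
  (the observable followed by the imaginary-time evolved perturbations at decreasing times
  `0 ≥ s₀ ≥ ⋯ ≥ s_{k-1} ≥ -β`); **`hasSum_dyson_trace_gibbsWeight_sum`** assembles the series.
* §3 Lattice fermions (`H₀ = dΓ(h)`, quartic `V = Σ_r v_r c†_{p₁r}c_{q₁r}c†_{p₂r}c_{q₂r}`,
  `O = c†_x c_y`): the coefficients are free expectations of time-ordered products of the evolved
  fields `a^±(s) = e^{sH₀}c^±e^{-sH₀}` of BGM (1.2) (`hasSum_dyson_trace_gibbsWeight_quartic`,
  `hasSum_dyson_partitionFn_quartic`); and the **Hubbard model** on any finite graph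
  (`hamiltonianWith G t U μ = dΓ(hubbardOneBody G t μ) + U Σ_x n_{x↑}n_{x↓}`,
  `hamiltonianWith_eq_dGamma_add_smul`): **`hasSum_hubbard_trace_gibbsWeight_twoPoint`**,
  `Tr(e^{-β(H-μN)} c†_{xσ}c_{yσ'}) = Σ_k U^k (-β)^k ∫ Σ_{x⃗∈Λ^k} Tr(e^{-βH₀} c†_{xσ}c_{yσ'}
  ∏_i a⁺_{x_i↑}(s_i)a⁻_{x_i↑}(s_i)a⁺_{x_i↓}(s_i)a⁻_{x_i↓}(s_i)) du`, and `hasSum_hubbard_partitionFn`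
  — numerator and denominator of BGM's (2.8) for the equal-time two-point Schwinger function.
  With the time-ordered Wick theorem for the Gibbs state of `dΓ(h)` the free expectations become
  the `(2k+1) × (2k+1)` determinants of the free propagator of (2.8); that step is not taken here.

Everything is PROVED; the only definition is `orderedIntegral`.

## Mathlib / tree search

Mathlib: `intervalIntegral.continuous_parametric_primitive_of_continuous`,
`ContinuousLinearMap.intervalIntegral_comp_comm`, `continuous_list_prod`, `List.ofFn_succ'`,
`Fin.consEquiv`; no iterated-simplex-integral API (`lean search 'orderedIntegral|simplexIntegral'`:
none). Tree: `DysonExpansion` (`Matrix.dysonTerm`, `Matrix.duhamelOp`, `Matrix.exp_sub_smul_eq`,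
`Matrix.hasSum_dyson_trace_gibbsWeight_mul`), `FermionQuasiFree` (`dGamma`, `hubbardOneBody`,
`hamiltonianWith_zero_eq_dGamma`), `HubbardModel`/`HubbardWave0` (`hamiltonianWith`, `numberOp`).

## References

* O. Bratteli, D. W. Robinson, *Operator Algebras and Quantum Statistical Mechanics I*, 2nd ed.
  (Springer 1987), Thm. 3.1.33 (the perturbation series of `e^{t(S+P)}` as iterated integrals).
  [BratteliRobinsonI1987]
* O. Bratteli, D. W. Robinson, *Operator Algebras and Quantum Statistical Mechanics II*, 2nd ed.
  (Springer 1997), §5.4.1 (perturbation of KMS states, Dyson series). [BratteliRobinsonII1997]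
* G. Benfatto, A. Giuliani, V. Mastropietro, Ann. Henri Poincaré 7 (2006) 809–898, §1.2 (1.2),
  §2.1 (2.6)–(2.8) (arXiv:cond-mat/0507686, pp. 2, 5–6). [BenfattoGiulianiMastropietro2006]
-/

noncomputable section

open scoped Matrix.Norms.L2Operator
open Finset MeasureTheory intervalIntegral Filter Topology NormedSpace

namespace Literature.MathematicalPhysics.QuantumLattice

/-! ### Iterated integrals over the ordered simplex -/

section OrderedIntegral

variable {E : Type*} [NormedAddCommGroup E] [NormedSpace ℝ E]

/-- The **iterated integral over the ordered simplex** `0 ≤ u₀ ≤ u₁ ≤ ⋯ ≤ u_{k-1} ≤ t` (last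
variable outermost): `I₀ F t = F ()`, `I_{k+1} F t = ∫₀ᵗ I_k (F(·, u)) u du`, i.e.
`I_k F t = ∫₀ᵗ du_{k-1} ∫₀^{u_{k-1}} du_{k-2} ⋯ ∫₀^{u₁} du₀ F(u₀, …, u_{k-1})`. This is the shape of
the `k`-th term of the Dyson series. Bratteli–Robinson I, Thm. 3.1.33. [folklore] -/
def orderedIntegral : (k : ℕ) → ((Fin k → ℝ) → E) → ℝ → E
  | 0, F, _ => F ![]
  | k + 1, F, t => ∫ u in (0:ℝ)..t, orderedIntegral k (fun w => F (Fin.snoc w u)) u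

/-- `I₀ F t = F ()`. [folklore] -/
@[simp] theorem orderedIntegral_zero (F : (Fin 0 → ℝ) → E) (t : ℝ) :
    orderedIntegral 0 F t = F ![] := rfl

/-- `I_{k+1} F t = ∫₀ᵗ I_k (F(·, u)) u du`. [folklore] -/
theorem orderedIntegral_succ (k : ℕ) (F : (Fin (k + 1) → ℝ) → E) (t : ℝ) :
    orderedIntegral (k + 1) F t =
      ∫ u in (0:ℝ)..t, orderedIntegral k (fun w => F (Fin.snoc w u)) u := rfl

/-- Appending a last coordinate is continuous. [folklore] -/
theorem continuous_finSnoc (k : ℕ) :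
    Continuous fun p : (Fin k → ℝ) × ℝ => (Fin.snoc p.1 p.2 : Fin (k + 1) → ℝ) := by
  refine continuous_pi fun i => ?_
  refine Fin.lastCases ?_ (fun j => ?_) i
  · simp only [Fin.snoc_last]
    exact continuous_snd
  · simp only [Fin.snoc_castSucc]
    exact (continuous_apply j).comp continuous_fst

/-- **Continuity of parametric ordered integrals**: if `F : X × ℝ^k → E` is jointly continuous and
`τ : X → ℝ` is continuous then `x ↦ I_k (F x) (τ x)` is continuous. [folklore] -/
theorem continuous_orderedIntegral {X : Type*} [TopologicalSpace X] :
    ∀ (k : ℕ) (F : X → (Fin k → ℝ) → E), Continuous (Function.uncurry F) →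
      ∀ τ : X → ℝ, Continuous τ → Continuous fun x => orderedIntegral k (F x) (τ x)
  | 0, F, hF, τ, _ => by
    exact hF.comp (continuous_id.prodMk (continuous_const (y := (![] : Fin 0 → ℝ))))
  | k + 1, F, hF, τ, hτ => by
    -- the inner integrals, jointly continuous in the parameter and the last variable
    have hG : Continuous (Function.uncurry fun (p : X × ℝ) (w : Fin k → ℝ) => F p.1 (Fin.snoc w p.2)) := by
      have : (Function.uncurry fun (p : X × ℝ) (w : Fin k → ℝ) => F p.1 (Fin.snoc w p.2)) =
          Function.uncurry F ∘ fun q : (X × ℝ) × (Fin k → ℝ) =>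
            (q.1.1, (Fin.snoc q.2 q.1.2 : Fin (k + 1) → ℝ)) := by
        funext q; rfl
      rw [this]
      exact hF.comp (continuous_fst.fst.prodMk
        ((continuous_finSnoc k).comp (continuous_snd.prodMk continuous_fst.snd)))
    have ih := continuous_orderedIntegral k (fun (p : X × ℝ) w => F p.1 (Fin.snoc w p.2)) hG
      Prod.snd continuous_snd
    have hprim := intervalIntegral.continuous_parametric_primitive_of_continuous
      (μ := volume) (a₀ := (0:ℝ))
      (f := fun (x : X) (u : ℝ) => orderedIntegral k (fun w => F x (Fin.snoc w u)) u) ih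
    exact hprim.comp (continuous_id.prodMk hτ)

/-- Ordered integrals of continuous integrands are continuous in the upper limit. [folklore] -/
theorem continuous_orderedIntegral_right (k : ℕ) {F : (Fin k → ℝ) → E} (hF : Continuous F) :
    Continuous (orderedIntegral k F) :=
  continuous_orderedIntegral k (fun _ : ℝ => F) (hF.comp continuous_snd) id continuous_id

/-- **Continuous linear maps commute with ordered integrals** (of continuous integrands).
[folklore] -/
theorem _root_.ContinuousLinearMap.orderedIntegral_comp_comm {E' : Type*} [NormedAddCommGroup E']
    [NormedSpace ℝ E'] [CompleteSpace E] [CompleteSpace E'] (L : E →L[ℝ] E') :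
    ∀ (k : ℕ) (F : (Fin k → ℝ) → E), Continuous F → ∀ t : ℝ,
      L (orderedIntegral k F t) = orderedIntegral k (fun w => L (F w)) t
  | 0, F, _, t => rfl
  | k + 1, F, hF, t => by
    rw [orderedIntegral_succ, orderedIntegral_succ]
    have hg : Continuous fun u : ℝ => orderedIntegral k (fun w => F (Fin.snoc w u)) u :=
      continuous_orderedIntegral k (fun (u : ℝ) w => F (Fin.snoc w u))
        (hF.comp ((continuous_finSnoc k).comp (continuous_snd.prodMk continuous_fst))) id
        continuous_id
    rw [← L.intervalIntegral_comp_comm (hg.intervalIntegrable 0 t)]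
    refine intervalIntegral.integral_congr fun u _ => ?_
    exact ContinuousLinearMap.orderedIntegral_comp_comm L k _
      (hF.comp ((continuous_finSnoc k).comp (continuous_id.prodMk continuous_const))) u

end OrderedIntegral

/-! ### The Dyson terms as ordered integrals of products of evolved perturbations -/

section Dyson

variable {m : Type*} [Fintype m] [DecidableEq m]

/-- The integrand of the `k`-th Dyson term: `(∏_{i<k} e^{u_i A} B e^{-u_i A}) e^{tA}` (ordered
product, `i` increasing from left to right). [folklore] -/
theorem continuous_dysonIntegrand (A B C : Matrix m m ℂ) (k : ℕ) :
    Continuous fun w : Fin k → ℝ =>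
      (List.ofFn fun i : Fin k => exp (w i • A) * B * exp (-(w i • A))).prod * C := by
  letI : NormedAlgebra ℚ (Matrix m m ℂ) := .restrictScalars ℚ ℂ _
  refine Continuous.mul ?_ continuous_const
  simp_rw [List.ofFn_eq_map]
  refine continuous_list_prod _ fun i _ => ?_
  have h1 : Continuous fun w : Fin k → ℝ => exp (w i • A) :=
    exp_continuous.comp ((continuous_apply i).smul continuous_const)
  have h2 : Continuous fun w : Fin k → ℝ => exp (-(w i • A)) :=
    exp_continuous.comp ((continuous_apply i).smul continuous_const).neg
  exact (h1.mul continuous_const).mul h2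

/-- **The Dyson terms are ordered integrals**:
`E_k(t) = ∫_{0≤u₀≤⋯≤u_{k-1}≤t} (e^{u₀A} B e^{-u₀A}) ⋯ (e^{u_{k-1}A} B e^{-u_{k-1}A}) e^{tA} du`, i.e.
`e^{u₀A} B e^{(u₁-u₀)A} B ⋯ B e^{(t-u_{k-1})A}` integrated over the ordered simplex.
Bratteli–Robinson I, Thm. 3.1.33; BGM 2006 §2.1. [cite: BratteliRobinsonI1987, Thm. 3.1.33] -/
theorem dysonTerm_eq_orderedIntegral (A B : Matrix m m ℂ) :
    ∀ (k : ℕ) (t : ℝ), Matrix.dysonTerm A B k t =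
      orderedIntegral k (fun w : Fin k → ℝ =>
        (List.ofFn fun i : Fin k => exp (w i • A) * B * exp (-(w i • A))).prod * exp (t • A)) t
  | 0, t => by simp
  | k + 1, t => by
    rw [Matrix.dysonTerm_succ, Matrix.duhamelOp, orderedIntegral_succ]
    refine intervalIntegral.integral_congr fun u _ => ?_
    rw [dysonTerm_eq_orderedIntegral A B k u]
    -- right multiplication by `B e^{(t-u)A}` commutes with the inner ordered integral
    set R : Matrix m m ℂ →L[ℝ] Matrix m m ℂ :=
      LinearMap.toContinuousLinearMap
        ((LinearMap.mulRight ℂ (B * exp ((t - u) • A))).restrictScalars ℝ) with hR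
    have hRapply : ∀ X : Matrix m m ℂ, R X = X * (B * exp ((t - u) • A)) := fun X => rfl
    rw [Matrix.mul_assoc, ← hRapply,
      R.orderedIntegral_comp_comm k _ (continuous_dysonIntegrand A B _ k) u]
    congr 1
    funext w
    rw [hRapply, List.ofFn_succ', List.prod_concat]
    simp only [Fin.snoc_castSucc, Fin.snoc_last]
    rw [Matrix.exp_sub_smul_eq A t u, neg_smul]
    noncomm_ring

/-- **The coefficients of the Dyson series of `Tr(e^{-β(H₀+gV)} O)` as ordered integrals.** With
`A = -βH₀`, `B = -βV`: `Tr(E_k(1) O) = ∫_{0≤u₀≤⋯≤u_{k-1}≤1} Tr((∏_i e^{u_iA} B e^{-u_iA}) e^{A} O) du`.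
BGM 2006 §2.1 (the "usual formal power series in `U`", here convergent in finite volume:
`Matrix.hasSum_dyson_trace_gibbsWeight_mul`). [cite: BenfattoGiulianiMastropietro2006, §2.1] -/
theorem trace_dysonTerm_mul_eq_orderedIntegral (A B O : Matrix m m ℂ) (k : ℕ) (t : ℝ) :
    (Matrix.dysonTerm A B k t * O).trace =
      orderedIntegral k (fun w : Fin k → ℝ =>
        ((List.ofFn fun i : Fin k => exp (w i • A) * B * exp (-(w i • A))).prod *
          exp (t • A) * O).trace) t := by
  set L : Matrix m m ℂ →L[ℝ] ℂ :=
    LinearMap.toContinuousLinearMap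
      (((Matrix.traceLinearMap m ℂ ℂ) ∘ₗ (LinearMap.mulRight ℂ O)).restrictScalars ℝ) with hL
  have hLapply : ∀ X : Matrix m m ℂ, L X = (X * O).trace := fun X => rfl
  rw [dysonTerm_eq_orderedIntegral, ← hLapply,
    L.orderedIntegral_comp_comm k _ (continuous_dysonIntegrand A B _ k) t]
  rfl

/-! ### Evaluating the integrand for a Gibbs weight and a perturbation given as a finite sum -/

/-- Conjugation is multiplicative: `e^{X}(YZ)e^{-X} = (e^{X}Ye^{-X})(e^{X}Ze^{-X})`. [folklore] -/
theorem exp_mul_mul_mul_exp_neg (X Y Z : Matrix m m ℂ) :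
    exp X * (Y * Z) * exp (-X) = (exp X * Y * exp (-X)) * (exp X * Z * exp (-X)) := by
  have h1 : exp (-X) * exp X = 1 := by
    rw [← Matrix.exp_add_of_commute _ _ (Commute.refl X).neg_left, neg_add_cancel, exp_zero]
  rw [show (exp X * Y * exp (-X)) * (exp X * Z * exp (-X)) =
      exp X * Y * (exp (-X) * exp X) * Z * exp (-X) by simp only [mul_assoc], h1, mul_one]
  simp only [mul_assoc]

/-- Conjugation of a finite sum of scaled operators. [folklore] -/
theorem exp_mul_sum_smul_mul_exp_neg {R : Type*} [Fintype R] (X : Matrix m m ℂ) (v : R → ℂ)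
    (W : R → Matrix m m ℂ) :
    exp X * (∑ r, v r • W r) * exp (-X) = ∑ r, v r • (exp X * W r * exp (-X)) := by
  simp only [Finset.mul_sum, Finset.sum_mul, Matrix.mul_smul, Matrix.smul_mul]

/-- **Ordered products distribute over finite sums**: for scalars `c`, `a i r` and operators
`T i r`, `∏_i (c Σ_r a_{ir} T_{ir}) = c^k Σ_{f : [k] → R} (∏_i a_{i f(i)}) ∏_i T_{i f(i)}`
(ordered products throughout). [folklore] -/
theorem prod_ofFn_smul_sum {R : Type*} [Fintype R] :
    ∀ (k : ℕ) (c : ℂ) (a : Fin k → R → ℂ) (T : Fin k → R → Matrix m m ℂ),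
      (List.ofFn fun i => c • ∑ r, a i r • T i r).prod =
        c ^ k • ∑ f : Fin k → R, (∏ i, a i (f i)) • (List.ofFn fun i => T i (f i)).prod
  | 0, c, a, T => by simp
  | k + 1, c, a, T => by
    rw [List.ofFn_succ, List.prod_cons, prod_ofFn_smul_sum k c (fun i => a i.succ) (fun i => T i.succ),
      smul_mul_smul, ← pow_succ', Finset.sum_mul]
    congr 1
    rw [← (Fin.consEquiv fun _ : Fin (k + 1) => R).sum_comp, Fintype.sum_prod_type]
    refine Finset.sum_congr rfl fun r _ => ?_
    rw [Matrix.smul_mul, Finset.mul_sum, Finset.smul_sum]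
    refine Finset.sum_congr rfl fun f _ => ?_
    simp only [Fin.consEquiv_apply, Fin.prod_univ_succ, Fin.cons_zero, Fin.cons_succ, List.ofFn_succ,
      List.prod_cons, Matrix.mul_smul, smul_smul]

/-- **The Dyson integrand of a Gibbs weight with a perturbation `V = Σ_r v_r W_r`.** With
`A = -βH₀`, `B = -βV`, for every observable `O` and all `u ∈ ℝ^k`:
`Tr((∏_i e^{u_iA} B e^{-u_iA}) e^{A} O) = (-β)^k Σ_{f : [k] → R} (∏_i v_{f(i)}) ·
  Tr(e^{-βH₀} O ∏_i (e^{s_i H₀} W_{f(i)} e^{-s_i H₀}))`, `s_i = -βu_i` — the un-normalised free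
expectation of the observable followed by the imaginary-time evolved perturbations at the
decreasing times `0 ≥ s₀ ≥ ⋯ ≥ s_{k-1} ≥ -β`. BGM 2006 §2.1 (2.6)–(2.8) at the operator level.
[cite: BenfattoGiulianiMastropietro2006, §2.1 (2.8)] -/
theorem trace_dysonIntegrand_gibbs {R : Type*} [Fintype R] (β : ℝ) (H₀ O : Matrix m m ℂ)
    (v : R → ℂ) (W : R → Matrix m m ℂ) (k : ℕ) (u : Fin k → ℝ) :
    ((List.ofFn fun i : Fin k =>
        exp (u i • (-(β : ℂ) • H₀)) * (-(β : ℂ) • ∑ r, v r • W r) * exp (-(u i • (-(β : ℂ) • H₀)))).prod *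
        exp ((1 : ℝ) • (-(β : ℂ) • H₀)) * O).trace =
      (-(β : ℂ)) ^ k * ∑ f : Fin k → R, (∏ i, v (f i)) *
        (Matrix.gibbsWeight β H₀ * (O * (List.ofFn fun i : Fin k =>
          exp ((((u i : ℝ) : ℂ) * -(β : ℂ)) • H₀) * W (f i) *
            exp (-((((u i : ℝ) : ℂ) * -(β : ℂ)) • H₀))).prod)).trace := by
  -- the evolved perturbations as finite sums
  have hfac : ∀ i : Fin k,
      exp (u i • (-(β : ℂ) • H₀)) * (-(β : ℂ) • ∑ r, v r • W r) * exp (-(u i • (-(β : ℂ) • H₀))) =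
        -(β : ℂ) • ∑ r, v r • (exp ((((u i : ℝ) : ℂ) * -(β : ℂ)) • H₀) * W r *
          exp (-((((u i : ℝ) : ℂ) * -(β : ℂ)) • H₀))) := by
    intro i
    rw [← Complex.coe_smul, smul_smul, Matrix.mul_smul, Matrix.smul_mul, exp_mul_sum_smul_mul_exp_neg]
  simp_rw [hfac]
  rw [prod_ofFn_smul_sum, one_smul, Matrix.smul_mul, Matrix.smul_mul, Matrix.trace_smul, smul_eq_mul,
    Finset.sum_mul, Finset.sum_mul, Matrix.trace_sum]
  refine congrArg (fun S => (-(β : ℂ)) ^ k * S) ?_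
  refine Finset.sum_congr rfl fun f _ => ?_
  rw [Matrix.smul_mul, Matrix.smul_mul, Matrix.trace_smul, smul_eq_mul, Matrix.trace_mul_cycle,
    Matrix.trace_mul_cycle O, Matrix.mul_assoc]
  rfl

/-- **The Dyson series of a perturbed Gibbs weight, coefficients as ordered integrals of free
correlation functions.** For `H = H₀ + g V`, `V = Σ_r v_r W_r`, and every observable `O`:
`Tr(e^{-βH} O) = Σ_k g^k (-β)^k ∫_{0≤u₀≤⋯≤u_{k-1}≤1} Σ_f (∏_i v_{f(i)})
  Tr(e^{-βH₀} O ∏_i e^{s_iH₀} W_{f(i)} e^{-s_iH₀}) du`, `s_i = -βu_i`, an entire series in `g` in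
finite dimension. BGM 2006 §2.1 (2.6)–(2.8) (there rewritten as Grassmann integrals);
Bratteli–Robinson II §5.4.1. [cite: BenfattoGiulianiMastropietro2006, §2.1 (2.8)] -/
theorem hasSum_dyson_trace_gibbsWeight_sum {R : Type*} [Fintype R] (β : ℝ) (H₀ O : Matrix m m ℂ)
    (v : R → ℂ) (W : R → Matrix m m ℂ) (g : ℂ) :
    HasSum (fun k : ℕ => g ^ k * orderedIntegral k (fun u : Fin k → ℝ =>
        (-(β : ℂ)) ^ k * ∑ f : Fin k → R, (∏ i, v (f i)) *
          (Matrix.gibbsWeight β H₀ * (O * (List.ofFn fun i : Fin k =>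
            exp ((((u i : ℝ) : ℂ) * -(β : ℂ)) • H₀) * W (f i) *
              exp (-((((u i : ℝ) : ℂ) * -(β : ℂ)) • H₀))).prod)).trace) 1)
      ((Matrix.gibbsWeight β (H₀ + g • ∑ r, v r • W r) * O).trace) := by
  have h := Matrix.hasSum_dyson_trace_gibbsWeight_mul β H₀ (∑ r, v r • W r) O g
  refine h.congr_fun fun k => ?_
  rw [trace_dysonTerm_mul_eq_orderedIntegral]
  exact congrArg (fun F => g ^ k * orderedIntegral k F 1)
    (funext fun u => (trace_dysonIntegrand_gibbs β H₀ O v W k u).symm)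

end Dyson

/-! ### Lattice fermions: quartic perturbations of a quadratic Hamiltonian, the Hubbard model -/

section Fermion

variable {ι : Type*} [LinearOrder ι] [Fintype ι]

/-- **Perturbation series of the two-point function of an interacting lattice fermion system,
coefficients as free expectations of time-ordered products.** For a one-body matrix `h`
(`H₀ = dΓ(h)`), a quartic perturbation `V = Σ_r v_r c†_{p₁r} c_{q₁r} c†_{p₂r} c_{q₂r}` and the
observable `c†_x c_y`:
`Tr(e^{-β(H₀+gV)} c†_x c_y) = Σ_k g^k (-β)^k ∫_{0≤u₀≤⋯≤u_{k-1}≤1} Σ_f (∏_i v_{f(i)}) ·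
  Tr(e^{-βH₀} c†_x c_y ∏_i a⁺_{p₁f(i)}(s_i) a⁻_{q₁f(i)}(s_i) a⁺_{p₂f(i)}(s_i) a⁻_{q₂f(i)}(s_i)) du`
with the imaginary-time evolved fields `a^±(s) = e^{sH₀} c^± e^{-sH₀}` (BGM (1.2) at `U = 0`) at
the decreasing times `s_i = -βu_i`: the numerator of BGM's (2.8) for the two-point Schwinger
function at equal times, at the operator level and convergent for every `g` in finite volume (the
free expectations are then determinants of the free propagator by the time-ordered Wick theorem).
BGM 2006 §1.2 (1.2), §2.1 (2.6)–(2.8). [cite: BenfattoGiulianiMastropietro2006, §2.1 (2.8)] -/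
theorem hasSum_dyson_trace_gibbsWeight_quartic {R : Type*} [Fintype R] (β : ℝ) (h : Matrix ι ι ℂ)
    (v : R → ℂ) (p₁ q₁ p₂ q₂ : R → ι) (x y : ι) (g : ℂ) :
    HasSum (fun k : ℕ => g ^ k * orderedIntegral k
      (fun u : Fin k → ℝ =>
        (-(β : ℂ)) ^ k * ∑ f : Fin k → R, (∏ i, v (f i)) *
          (Matrix.gibbsWeight β (dGamma h) * (creation x * annihilation y *
            (List.ofFn fun i : Fin k =>
              (exp ((((u i : ℝ) : ℂ) * -(β : ℂ)) • dGamma h) * creation (p₁ (f i)) * exp (-((((u i : ℝ) : ℂ) * -(β : ℂ)) • dGamma h))) * (exp ((((u i : ℝ) : ℂ) * -(β : ℂ)) • dGamma h) * annihilation (q₁ (f i)) * exp (-((((u i : ℝ) : ℂ) * -(β : ℂ)) • dGamma h))) *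
                ((exp ((((u i : ℝ) : ℂ) * -(β : ℂ)) • dGamma h) * creation (p₂ (f i)) * exp (-((((u i : ℝ) : ℂ) * -(β : ℂ)) • dGamma h))) * (exp ((((u i : ℝ) : ℂ) * -(β : ℂ)) • dGamma h) * annihilation (q₂ (f i)) * exp (-((((u i : ℝ) : ℂ) * -(β : ℂ)) • dGamma h))))).prod)).trace) 1)
      ((Matrix.gibbsWeight β (dGamma h + g • ∑ r, v r •
          (creation (p₁ r) * annihilation (q₁ r) * (creation (p₂ r) * annihilation (q₂ r)))) *
        (creation x * annihilation y)).trace) := by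
  have hs := hasSum_dyson_trace_gibbsWeight_sum β (dGamma h) (creation x * annihilation y) v
    (fun r => creation (p₁ r) * annihilation (q₁ r) * (creation (p₂ r) * annihilation (q₂ r))) g
  simp only [exp_mul_mul_mul_exp_neg] at hs
  exact hs

/-- The same for the partition function: `Tr e^{-β(H₀+gV)} = Σ_k g^k (-β)^k ∫ Σ_f (∏_i v_{f(i)})
Tr(e^{-βH₀} ∏_i a⁺_{p₁f(i)}(s_i) a⁻_{q₁f(i)}(s_i) a⁺_{p₂f(i)}(s_i) a⁻_{q₂f(i)}(s_i)) du` — the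
denominator of BGM's (2.8), i.e. (2.6), at the operator level. BGM 2006 §2.1 (2.6).
[cite: BenfattoGiulianiMastropietro2006, §2.1 (2.6)] -/
theorem hasSum_dyson_partitionFn_quartic {R : Type*} [Fintype R] (β : ℝ) (h : Matrix ι ι ℂ)
    (v : R → ℂ) (p₁ q₁ p₂ q₂ : R → ι) (g : ℂ) :
    HasSum (fun k : ℕ => g ^ k * orderedIntegral k
      (fun u : Fin k → ℝ =>
        (-(β : ℂ)) ^ k * ∑ f : Fin k → R, (∏ i, v (f i)) *
          (Matrix.gibbsWeight β (dGamma h) *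
            (List.ofFn fun i : Fin k =>
              (exp ((((u i : ℝ) : ℂ) * -(β : ℂ)) • dGamma h) * creation (p₁ (f i)) * exp (-((((u i : ℝ) : ℂ) * -(β : ℂ)) • dGamma h))) * (exp ((((u i : ℝ) : ℂ) * -(β : ℂ)) • dGamma h) * annihilation (q₁ (f i)) * exp (-((((u i : ℝ) : ℂ) * -(β : ℂ)) • dGamma h))) *
                ((exp ((((u i : ℝ) : ℂ) * -(β : ℂ)) • dGamma h) * creation (p₂ (f i)) * exp (-((((u i : ℝ) : ℂ) * -(β : ℂ)) • dGamma h))) * (exp ((((u i : ℝ) : ℂ) * -(β : ℂ)) • dGamma h) * annihilation (q₂ (f i)) * exp (-((((u i : ℝ) : ℂ) * -(β : ℂ)) • dGamma h))))).prod).trace) 1)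
      (Matrix.partitionFn β (dGamma h + g • ∑ r, v r •
          (creation (p₁ r) * annihilation (q₁ r) * (creation (p₂ r) * annihilation (q₂ r))))) := by
  have hs := hasSum_dyson_trace_gibbsWeight_sum β (dGamma h) 1 v
    (fun r => creation (p₁ r) * annihilation (q₁ r) * (creation (p₂ r) * annihilation (q₂ r))) g
  simp only [exp_mul_mul_mul_exp_neg, Matrix.one_mul, Matrix.mul_one] at hs
  exact hs

end Fermion

/-! ### The Hubbard model -/

section Hubbard

variable {Λ : Type*} [LinearOrder Λ] [Fintype Λ] (G : SimpleGraph Λ) [DecidableRel G.Adj]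

/-- The grand-canonical Hubbard Hamiltonian is the free one plus `U` times the on-site quartic
term: `H(t,U) - μN = dΓ(h) + U Σ_x c†_{x↑}c_{x↑}c†_{x↓}c_{x↓}`, `h = hubbardOneBody G t μ`.
BGM 2006 (1.1), §2.1. [cite: BenfattoGiulianiMastropietro2006, eq. (1.1)] -/
theorem hamiltonianWith_eq_dGamma_add_smul (t U μ : ℝ) :
    hamiltonianWith G t U μ = dGamma (hubbardOneBody G t μ) + (U : ℂ) • ∑ x : Λ,
      creation (orb x 0) * annihilation (orb x 0) * (creation (orb x 1) * annihilation (orb x 1)) := by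
  rw [← hamiltonianWith_zero_eq_dGamma]
  simp only [hamiltonianWith, hamiltonian, Complex.ofReal_zero, zero_smul, add_zero, numberOp]
  abel

/-- **The perturbation series of the Hubbard two-point function in `U` (finite volume).** On any
finite graph, for all `β, t, μ, U` and orbitals `(x,σ), (y,σ')`:
`Tr(e^{-β(H(t,U)-μN)} c†_{xσ} c_{yσ'}) = Σ_k U^k (-β)^k ∫_{0≤u₀≤⋯≤u_{k-1}≤1} Σ_{x⃗ ∈ Λ^k}
  Tr(e^{-βH₀} c†_{xσ}c_{yσ'} ∏_i a⁺_{x_i↑}(s_i)a⁻_{x_i↑}(s_i)a⁺_{x_i↓}(s_i)a⁻_{x_i↓}(s_i)) du`,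
`s_i = -βu_i`, `a^±(s) = e^{sH₀}c^±e^{-sH₀}`, `H₀ = dΓ(hubbardOneBody G t μ)` — BGM's expansion (2.8)
of the equal-time two-point Schwinger function (numerator), before the Wick rule turns the free
expectations into determinants of the free propagator (1.3)–(1.4); an entire series in `U` in every
finite volume. BGM 2006 §2.1 (2.6)–(2.8). [cite: BenfattoGiulianiMastropietro2006, §2.1 (2.8)] -/
theorem hasSum_hubbard_trace_gibbsWeight_twoPoint (β t U μ : ℝ) (x y : Λ) (σ σ' : Fin 2) :
    HasSum (fun k : ℕ => (U : ℂ) ^ k * orderedIntegral k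
      (fun u : Fin k → ℝ =>
        (-(β : ℂ)) ^ k * ∑ f : Fin k → Λ, 
          (Matrix.gibbsWeight β (dGamma (hubbardOneBody G t μ)) * (creation (orb x σ) * annihilation (orb y σ') *
            (List.ofFn fun i : Fin k =>
              (exp ((((u i : ℝ) : ℂ) * -(β : ℂ)) • dGamma (hubbardOneBody G t μ)) * creation (orb (f i) 0) * exp (-((((u i : ℝ) : ℂ) * -(β : ℂ)) • dGamma (hubbardOneBody G t μ)))) * (exp ((((u i : ℝ) : ℂ) * -(β : ℂ)) • dGamma (hubbardOneBody G t μ)) * annihilation (orb (f i) 0) * exp (-((((u i : ℝ) : ℂ) * -(β : ℂ)) • dGamma (hubbardOneBody G t μ)))) *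
                ((exp ((((u i : ℝ) : ℂ) * -(β : ℂ)) • dGamma (hubbardOneBody G t μ)) * creation (orb (f i) 1) * exp (-((((u i : ℝ) : ℂ) * -(β : ℂ)) • dGamma (hubbardOneBody G t μ)))) * (exp ((((u i : ℝ) : ℂ) * -(β : ℂ)) • dGamma (hubbardOneBody G t μ)) * annihilation (orb (f i) 1) * exp (-((((u i : ℝ) : ℂ) * -(β : ℂ)) • dGamma (hubbardOneBody G t μ)))))).prod)).trace) 1)
      ((Matrix.gibbsWeight β (hamiltonianWith G t U μ) *
        (creation (orb x σ) * annihilation (orb y σ'))).trace) := by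
  have hs := hasSum_dyson_trace_gibbsWeight_quartic β (hubbardOneBody G t μ) (fun _ : Λ => (1 : ℂ))
    (fun z => orb z 0) (fun z => orb z 0) (fun z => orb z 1) (fun z => orb z 1) (orb x σ) (orb y σ')
    (U : ℂ)
  simp only [Finset.prod_const_one, one_mul, one_smul] at hs
  rw [hamiltonianWith_eq_dGamma_add_smul]
  exact hs

/-- **The perturbation series of the Hubbard partition function in `U` (finite volume)** — BGM's
(2.6) at the operator level. [cite: BenfattoGiulianiMastropietro2006, §2.1 (2.6)] -/
theorem hasSum_hubbard_partitionFn (β t U μ : ℝ) :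
    HasSum (fun k : ℕ => (U : ℂ) ^ k * orderedIntegral k
      (fun u : Fin k → ℝ =>
        (-(β : ℂ)) ^ k * ∑ f : Fin k → Λ, 
          (Matrix.gibbsWeight β (dGamma (hubbardOneBody G t μ)) *
            (List.ofFn fun i : Fin k =>
              (exp ((((u i : ℝ) : ℂ) * -(β : ℂ)) • dGamma (hubbardOneBody G t μ)) * creation (orb (f i) 0) * exp (-((((u i : ℝ) : ℂ) * -(β : ℂ)) • dGamma (hubbardOneBody G t μ)))) * (exp ((((u i : ℝ) : ℂ) * -(β : ℂ)) • dGamma (hubbardOneBody G t μ)) * annihilation (orb (f i) 0) * exp (-((((u i : ℝ) : ℂ) * -(β : ℂ)) • dGamma (hubbardOneBody G t μ)))) *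
                ((exp ((((u i : ℝ) : ℂ) * -(β : ℂ)) • dGamma (hubbardOneBody G t μ)) * creation (orb (f i) 1) * exp (-((((u i : ℝ) : ℂ) * -(β : ℂ)) • dGamma (hubbardOneBody G t μ)))) * (exp ((((u i : ℝ) : ℂ) * -(β : ℂ)) • dGamma (hubbardOneBody G t μ)) * annihilation (orb (f i) 1) * exp (-((((u i : ℝ) : ℂ) * -(β : ℂ)) • dGamma (hubbardOneBody G t μ)))))).prod).trace) 1)
      (Matrix.partitionFn β (hamiltonianWith G t U μ)) := by
  have hs := hasSum_dyson_partitionFn_quartic β (hubbardOneBody G t μ) (fun _ : Λ => (1 : ℂ))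
    (fun z => orb z 0) (fun z => orb z 0) (fun z => orb z 1) (fun z => orb z 1) (U : ℂ)
  simp only [Finset.prod_const_one, one_mul, one_smul] at hs
  rw [hamiltonianWith_eq_dGamma_add_smul]
  exact hs

end Hubbard

end Literature.MathematicalPhysics.QuantumLattice
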